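import Summits.AnomalousDissipation.AnomalousDissipation.Theorems.SolenoidalFractalHomogenisationLagrangianStepSectorCount
import Literature.Analysis.FunctionSpaces.TorusSpectralWeakDerivative
import Literature.Analysis.FunctionSpaces.TorusHeatSmoothing
import HarnessLib

/-!
# The class-`R` datum tail: above frequency `L` an `H¹`-class datum carries at most `R/(4π²L²)` of its energy (K1L_D helper)

Helper file of route `SolenoidalFractalHomogenisation`, crux K1L_D `LagrangianRenormalisationStepDesign` (stmt-AnomalousDissipation-27980),
registered stub `stub_oneLevelL_IW` (skeleton «onelevel-design» v2; item 1 of the lead's consumer memo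
`Cruxes/LagrangianRenormalisationStep/B-lead-1.md`): the one-level comparison tracks only the ACTIVE BAND `‖ℓ‖ ≤ L` of the datum and needs the
rest to be small.  For a datum `w₀ ∈ L²(T³; ℝ³)` of length-scale class `R` (`InClass R w₀`: `‖∇w₀‖² ≤ R ‖w₀‖²`, spectral gradient norm
`Torus.eGradNormSq`) and every `L > 0`:

  `∫ ‖w₀‖² − lowEnergy L w₀ ≤ (R / (4π² L²)) · ∫ ‖w₀‖²`                                      (`integral_norm_sq_sub_lowEnergy_le_of_inClass`)

(`lowEnergy L` = the energy of the modes of the slow box `‖k‖ ≤ L`, `…LagrangianStepDefs`).  Ingredients, all in the tree: Parseval for real vector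
fields (`Torus.hasSum_sq_norm_mFourierCoeff_complexify`, whence the TAIL IDENTITY `hasSum_sectorEnergy_tail`: the complement of the slow box sums to
`∫‖w₀‖² − lowEnergy L w₀`), the spectral gradient norm `Torus.eGradNormSq_eq_tsum` (`= 4π² Σ_k |k|² ‖ŵ₀(k)‖²`), and `|k|² > L²` off the slow box
(`lt_norm_of_not_mem_slowBox`, converse of p638936's `norm_le_of_mem_slowBox`).  The extended-real form `ofReal_tail_mul_le_eGradNormSq` needs no
class.  No definitions, no named facts, no sorry.  This is NOT a proof of the one-level comparison, of the crux, of Onsager's conjecture or of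
anomalous dissipation — rung-leaf F-D1.A0 bookkeeping only.  Prover seat `ad-k3l-bookkeeping-p1` g4, 2026-08-28.
-/

set_option linter.dupNamespace false

noncomputable section

namespace Summit.AnomalousDissipation.AnomalousDissipation.Theorems.SolenoidalFractalHomogenisation.LagrangianStep

open Literature.Analysis Literature.Analysis.FluidPDE Literature.Analysis.FunctionSpaces
open Literature.Analysis.FluidPDE.LatticeShear
open MeasureTheory Set Filter Function UnitAddTorus
open scoped ENNReal NNReal InnerProductSpace Topology
open Summit.AnomalousDissipation.AnomalousDissipation.Theorems.SolenoidalFractalHomogenisation.RealisedQuasiStaticCellLaw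

/-! ## The slow box from outside -/

/-- Converse of `norm_le_of_mem_slowBox`: a frequency of norm `≤ L` lies in the slow box (its coordinates are `≤ L ≤ ⌈L⌉` in absolute value).
[folklore] -/
theorem mem_slowBox_of_norm_le {L : ℝ} {k : Fin 3 → ℤ} (h : ‖Torus.latticeVec k‖ ≤ L) : k ∈ slowBox L := by
  refine Finset.mem_filter.2 ⟨Fintype.mem_piFinset.2 fun i => Finset.mem_Icc.2 ⟨?_, ?_⟩, h⟩
  · have h1 : |(k i : ℝ)| ≤ L := (abs_coord_le_norm_latticeVec k i).trans h
    have h2 : -L ≤ (k i : ℝ) := by linarith [neg_abs_le (k i : ℝ)]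
    have h3 : ((-⌈L⌉ : ℤ) : ℝ) ≤ (k i : ℝ) := by
      have := Int.le_ceil L
      push_cast
      linarith
    exact_mod_cast h3
  · have h1 : |(k i : ℝ)| ≤ L := (abs_coord_le_norm_latticeVec k i).trans h
    have h3 : (k i : ℝ) ≤ ((⌈L⌉ : ℤ) : ℝ) := ((le_abs_self _).trans h1).trans (Int.le_ceil L)
    exact_mod_cast h3

/-- Off the slow box the frequency norm exceeds `L`. [folklore] -/
theorem lt_norm_of_not_mem_slowBox {L : ℝ} {k : Fin 3 → ℤ} (h : k ∉ slowBox L) : L < ‖Torus.latticeVec k‖ :=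
  lt_of_not_ge fun h' => h (mem_slowBox_of_norm_le h')

/-- Off the slow box (`L > 0`): `L² ≤ |k|²` (`freqNormSq`). [folklore] -/
theorem sq_le_freqNormSq_of_not_mem_slowBox {L : ℝ} (hL : 0 < L) {k : Fin 3 → ℤ} (h : k ∉ slowBox L) :
    L ^ 2 ≤ Torus.freqNormSq k := by
  rw [← Torus.norm_latticeVec_sq]
  exact pow_le_pow_left₀ hL.le (lt_norm_of_not_mem_slowBox h).le 2

/-! ## The tail identity -/

/-- Parseval in sector form: `Σ_k sectorEnergy k F = ∫‖F‖²` for `F ∈ L²`. [cite: Grafakos2014, Prop. 3.2.7 (3)] -/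
theorem hasSum_sectorEnergy {F : VF} (hF2 : MemLp F 2 volume) :
    HasSum (fun k : Fin 3 → ℤ => sectorEnergy k F) (∫ x, ‖F x‖ ^ 2) := by
  have hFi : Integrable F volume := hF2.integrable one_le_two
  have h := FunctionSpaces.Torus.hasSum_sq_norm_mFourierCoeff_complexify hF2
  convert h using 1
  funext k
  exact sectorEnergy_eq hFi k

/-- **Tail identity**: the sector energies OFF the slow box sum to `∫‖F‖² − lowEnergy L F`. [cite: Grafakos2014, Prop. 3.2.7 (3)] -/
theorem hasSum_sectorEnergy_tail {F : VF} (hF2 : MemLp F 2 volume) (L : ℝ) :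
    HasSum (fun k : Fin 3 → ℤ => if k ∈ slowBox L then 0 else sectorEnergy k F) ((∫ x, ‖F x‖ ^ 2) - lowEnergy L F) := by
  classical
  have hPars := hasSum_sectorEnergy hF2
  have hlow : HasSum (fun k : Fin 3 → ℤ => if k ∈ slowBox L then sectorEnergy k F else 0) (lowEnergy L F) := by
    rw [lowEnergy_eq_sum]
    have h : HasSum (fun k : Fin 3 → ℤ => if k ∈ slowBox L then sectorEnergy k F else 0)
        (∑ b ∈ slowBox L, (if b ∈ slowBox L then sectorEnergy b F else 0)) :=
      hasSum_sum_of_ne_finset_zero fun b hb => if_neg hb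
    have e : ∑ b ∈ slowBox L, (if b ∈ slowBox L then sectorEnergy b F else 0) = ∑ k ∈ slowBox L, sectorEnergy k F :=
      Finset.sum_congr rfl fun b hb => if_pos hb
    rwa [e] at h
  have e : (fun k : Fin 3 → ℤ => if k ∈ slowBox L then 0 else sectorEnergy k F) =
      fun k => sectorEnergy k F - (if k ∈ slowBox L then sectorEnergy k F else 0) := by
    funext k
    split_ifs <;> simp
  rw [e]
  exact hPars.sub hlow

/-- The tail is nonnegative: `lowEnergy L F ≤ ∫‖F‖²`. [folklore] -/
theorem lowEnergy_le_integral_norm_sq {F : VF} (hF2 : MemLp F 2 volume) (L : ℝ) : lowEnergy L F ≤ ∫ x, ‖F x‖ ^ 2 := by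
  have h := hasSum_sectorEnergy_tail hF2 L
  have h0 : 0 ≤ (∫ x, ‖F x‖ ^ 2) - lowEnergy L F :=
    h.nonneg fun k => by split_ifs <;> [exact le_rfl; exact sectorEnergy_nonneg k F]
  linarith

/-- Clause shape: on the (probability) torus `∫ (‖F‖² − lowEnergy L F) = (∫‖F‖²) − lowEnergy L F` (the form in which the cell clauses (C)
are typed, cf. `…CellCorrectorContent`). [folklore] -/
theorem integral_norm_sq_sub_lowEnergy_eq {F : VF} (hF2 : MemLp F 2 volume) (L : ℝ) :
    ∫ x, (‖F x‖ ^ 2 - lowEnergy L F) = (∫ x, ‖F x‖ ^ 2) - lowEnergy L F := by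
  rw [integral_sub (hF2.integrable_norm_pow two_ne_zero) (integrable_const _), integral_const]
  simp

/-! ## The tail bound -/

/-- **Spectral tail bound, extended-real form (no class needed)**: `4π²L² · (∫‖F‖² − lowEnergy L F) ≤ ‖∇F‖²` (`Torus.eGradNormSq`), for
`F ∈ L²(T³; ℝ³)` and `L > 0` — termwise `|k|² ≥ L²` off the slow box. [cite: Grafakos2014, Prop. 3.2.7 (3)] -/
theorem ofReal_tail_mul_le_eGradNormSq {F : VF} (hF2 : MemLp F 2 volume) {L : ℝ} (hL : 0 < L) :
    ENNReal.ofReal (4 * Real.pi ^ 2 * L ^ 2) * ENNReal.ofReal ((∫ x, ‖F x‖ ^ 2) - lowEnergy L F) ≤ Torus.eGradNormSq F := by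
  classical
  have hFi : Integrable F volume := hF2.integrable one_le_two
  have htail := hasSum_sectorEnergy_tail hF2 L
  have hnn : ∀ k : Fin 3 → ℤ, 0 ≤ (if k ∈ slowBox L then 0 else sectorEnergy k F) := fun k => by
    split_ifs <;> [exact le_rfl; exact sectorEnergy_nonneg k F]
  rw [← htail.tsum_eq, ENNReal.ofReal_tsum_of_nonneg hnn htail.summable, ← ENNReal.tsum_mul_left,
    Torus.eGradNormSq_eq_tsum, ← ENNReal.tsum_mul_left]
  refine ENNReal.tsum_le_tsum fun k => ?_
  by_cases hk : k ∈ slowBox L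
  · simp [hk]
  · rw [if_neg hk]
    have hfreq : L ^ 2 ≤ Torus.freqNormSq k := sq_le_freqNormSq_of_not_mem_slowBox hL hk
    have hse : ENNReal.ofReal (sectorEnergy k F) = ‖mFourierCoeff (FunctionSpaces.EuclideanSpace.complexify ∘ F) k‖ₑ ^ 2 := by
      rw [sectorEnergy_eq hFi, ← ofReal_norm, ENNReal.ofReal_pow (norm_nonneg _)]
    rw [hse, ENNReal.ofReal_mul (by positivity), mul_assoc]
    gcongr

/-- **The class-`R` datum tail**: for `F ∈ L²(T³; ℝ³)` of class `R` (`‖∇F‖² ≤ R ‖F‖²`) and `L > 0`,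
`∫‖F‖² − lowEnergy L F ≤ (R / (4π²L²)) · ∫‖F‖²`. [folklore] -/
theorem integral_norm_sq_sub_lowEnergy_le_of_inClass {R : ℝ≥0} {F : VF} (hF2 : MemLp F 2 volume) (hcl : InClass R F)
    {L : ℝ} (hL : 0 < L) :
    (∫ x, ‖F x‖ ^ 2) - lowEnergy L F ≤ (R : ℝ) / (4 * Real.pi ^ 2 * L ^ 2) * ∫ x, ‖F x‖ ^ 2 := by
  have hc : 0 < 4 * Real.pi ^ 2 * L ^ 2 := by positivity
  have hE : 0 ≤ ∫ x, ‖F x‖ ^ 2 := integral_nonneg fun x => by positivity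
  have h1 := ofReal_tail_mul_le_eGradNormSq hF2 hL
  have h2 : Torus.eGradNormSq F ≤ (R : ℝ≥0∞) * ENNReal.ofReal (∫ x, ‖F x‖ ^ 2) := hcl
  have h3 : ENNReal.ofReal (4 * Real.pi ^ 2 * L ^ 2) * ENNReal.ofReal ((∫ x, ‖F x‖ ^ 2) - lowEnergy L F) ≤
      ENNReal.ofReal ((R : ℝ) * ∫ x, ‖F x‖ ^ 2) := by
    rw [ENNReal.ofReal_mul R.coe_nonneg, ENNReal.ofReal_coe_nnreal]
    exact h1.trans h2
  have h4 : ENNReal.ofReal ((∫ x, ‖F x‖ ^ 2) - lowEnergy L F) ≤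
      ENNReal.ofReal ((R : ℝ) * ∫ x, ‖F x‖ ^ 2) / ENNReal.ofReal (4 * Real.pi ^ 2 * L ^ 2) := by
    rw [ENNReal.le_div_iff_mul_le (Or.inl (ENNReal.ofReal_pos.2 hc).ne') (Or.inl ENNReal.ofReal_ne_top), mul_comm]
    exact h3
  rw [← ENNReal.ofReal_div_of_pos hc] at h4
  have h5 := (ENNReal.ofReal_le_ofReal_iff (by positivity)).1 h4
  calc (∫ x, ‖F x‖ ^ 2) - lowEnergy L F ≤ (R : ℝ) * (∫ x, ‖F x‖ ^ 2) / (4 * Real.pi ^ 2 * L ^ 2) := h5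
    _ = (R : ℝ) / (4 * Real.pi ^ 2 * L ^ 2) * ∫ x, ‖F x‖ ^ 2 := by ring

/-- The same for a DATUM of the one-level step (`IsDatum`: `H¹`, mean zero, weakly divergence free — only `H¹ ⊆ L²` is used) of class `R`.
[folklore] -/
theorem integral_norm_sq_sub_lowEnergy_le_of_isDatum {R : ℝ≥0} {w₀ : VF} (hw : IsDatum w₀) (hcl : InClass R w₀) {L : ℝ} (hL : 0 < L) :
    (∫ x, ‖w₀ x‖ ^ 2) - lowEnergy L w₀ ≤ (R : ℝ) / (4 * Real.pi ^ 2 * L ^ 2) * ∫ x, ‖w₀ x‖ ^ 2 :=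
  integral_norm_sq_sub_lowEnergy_le_of_inClass (memLp_two_of_memSobolev_one_complexify hw.1) hcl hL

/-- Class form of the tail in terms of `Torus.vectorL2Sq` (the energy `E₀` of the glue files): `∫‖w₀‖² − lowEnergy L w₀ ≤ R·E₀/(4π²L²)`.
[folklore] -/
theorem integral_norm_sq_sub_lowEnergy_le_vectorL2Sq {R : ℝ≥0} {w₀ : VF} (hw : IsDatum w₀) (hcl : InClass R w₀) {L : ℝ} (hL : 0 < L) :
    (∫ x, ‖w₀ x‖ ^ 2) - lowEnergy L w₀ ≤ (R : ℝ) * Torus.vectorL2Sq w₀ / (4 * Real.pi ^ 2 * L ^ 2) := by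
  have h := integral_norm_sq_sub_lowEnergy_le_of_isDatum hw hcl hL
  have e : Torus.vectorL2Sq w₀ = ∫ x, ‖w₀ x‖ ^ 2 := rfl
  rw [e]
  calc (∫ x, ‖w₀ x‖ ^ 2) - lowEnergy L w₀ ≤ (R : ℝ) / (4 * Real.pi ^ 2 * L ^ 2) * ∫ x, ‖w₀ x‖ ^ 2 := h
    _ = (R : ℝ) * (∫ x, ‖w₀ x‖ ^ 2) / (4 * Real.pi ^ 2 * L ^ 2) := by ring

end Summit.AnomalousDissipation.AnomalousDissipation.Theorems.SolenoidalFractalHomogenisation.LagrangianStep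

end
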